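import Literature.NumberTheory.Sieve.Maynard2016LargeGapsStatements
import Literature.NumberTheory.LFunctions.RHWave0PNTProofs
import HarnessLib

/-!
# Maynard 2016, §2: PROOF of the reduction "Theorem 1 assuming Proposition 5"
# (`Maynard2016.Reduction`: Lemma 2 ∧ Lemma 4 ∧ Proposition 5 ⇒ `[1, U]` is covered for every `C_U`)

Topic `Literature/NumberTheory/Sieve`. Everything in this file is PROVED; it discharges the named
fact `Maynard2016.Reduction` of `Maynard2016LargeGapsStatements.lean` (block [M-d] of the ladder's
Tier-2 seat plan), i.e. it formalises p. 4 of arXiv:1408.5110: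

  "Proof of Theorem 1 assuming Proposition 5. By Lemma 4, `Σ_{m < U z⁻¹ (log₂ x)⁻²} δ|𝓡_m| log x
  ≪ δ C_U x`. Therefore, if `δ` is sufficiently small compared with `C_U`, we can choose intervals
  `𝓘_m` of length `δ|𝓡_m| log x` for each even `m < U z⁻¹ (log₂ x)⁻²` such that all the `𝓘_m` are
  disjoint and contained in `[x/2, x]`. By Proposition 5 we can cover `𝓡_m` using a residue class
  for each prime in `𝓘_m`, for each such `m`. By Lemmas 2, 3 and 4, this means we can cover all but
  `o(x/log x)` elements of `𝓡` using only residue classes of primes in `[x/2, x]`. By choosing the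
  residue class of one remaining element for each prime in `[z, x/2]`, we can then cover all the
  remaining elements of `𝓡`. Therefore we can choose residue classes `a_p (mod p)` for all `p ≤ x`
  which cover all of `[1, U]`, for any fixed choice of `C_U`."

Structure: `residueClassesCover_of_injOn_compl` (the final matching, a variant of the ladder's
`residueClassesCover_of_injOn` with the matched primes in the MIDDLE range `(z, x/2)`);
`stage_one_survivor` (after `a_p = 1 (p ≤ y)`, `a_p = 0 (y < p ≤ z)` every survivor `n ≤ U` lies in
`𝓡'` or is `m · p` with `p ∈ 𝓡_m` — note `𝓡_m` as typed does not require `m` to be `y`-smooth, so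
`U < z²` is not needed here); `cover_core` (all parameters and the four numerical inputs explicit:
disjoint intervals `𝓘_m = [x/2 + S_m, x/2 + S_m + δ|𝓡_m| log x]` separated by unit gaps, the
Proposition-5 classes multiplied by `m` — "`p ≡ a_q (mod q)` for `p ∈ 𝓡_m`" covers `mp`, since the
class used for `mp` is `m a_q` —, the count of what is left against the primes in `(z, x/2)`);
the growth lemmas (`y, z → ∞`, `y ≤ z < x/2`, `⌈U z⁻¹ (log₂ x)⁻²⌉ ≤ x/4`, `(log x)^ε ≥ 8K`, and the
prime number theorem on `(z, x/2)` via `primeCounting_isEquivalent_holds`); and `reduction_holds`.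

## References

* J. Maynard, *Large gaps between primes*, Ann. of Math. (2) 183 (2016), 915–933; arXiv:1408.5110,
  §2, proof of Theorem 1 assuming Proposition 5. [Maynard2016LargeGaps]
-/

open Filter Finset
open scoped Topology

namespace Literature.NumberTheory.Sieve

namespace Maynard2016

/-! ### The final matching with the primes in a prescribed set -/

/-- If every `t ≤ N` outside a finite set `T` is covered by a class `a_p` of a prime `p ≤ x` NOT in
`Q`, and `T` injects into `Q ⊆ {primes ≤ x}`, then `[1, N]` is covered by classes of the primes
`≤ x` ("choosing the residue class of one remaining element for each prime in `[z, x/2]`").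
[cite: Maynard2016LargeGaps, §2, proof of Theorem 1 (penultimate sentence)] -/
theorem residueClassesCover_of_injOn_compl {x N : ℕ} (Q : Finset ℕ) (a : ℕ → ℕ) (T : Finset ℕ)
    (hcov : ∀ t : ℕ, 1 ≤ t → t ≤ N → t ∉ T →
      ∃ p : ℕ, p.Prime ∧ p ≤ x ∧ p ∉ Q ∧ t ≡ a p [MOD p])
    (q : ℕ → ℕ) (hinj : Set.InjOn q T) (hq : ∀ t ∈ T, q t ∈ Q)
    (hQ : ∀ p ∈ Q, p.Prime ∧ p ≤ x) : ResidueClassesCover x N := by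
  classical
  refine ⟨fun p => if h : ∃ t ∈ T, q t = p then h.choose else a p, fun t ht1 htN => ?_⟩
  by_cases htT : t ∈ T
  · have h : ∃ t' ∈ T, q t' = q t := ⟨t, htT, rfl⟩
    refine ⟨q t, (hQ _ (hq t htT)).1, (hQ _ (hq t htT)).2, ?_⟩
    have h1 : h.choose ∈ T := h.choose_spec.1
    have h2 : q h.choose = q t := h.choose_spec.2
    have h3 : h.choose = t := hinj h1 htT h2
    show t ≡ (if h : ∃ t' ∈ T, q t' = q t then h.choose else a (q t)) [MOD q t]
    rw [dif_pos h, h3]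
  · obtain ⟨p, hp, hpx, hpQ, htp⟩ := hcov t ht1 htN htT
    refine ⟨p, hp, hpx, ?_⟩
    have h : ¬ ∃ t' ∈ T, q t' = p := by
      rintro ⟨t', ht', rfl⟩; exact hpQ (hq t' ht')
    show t ≡ (if h : ∃ t' ∈ T, q t' = p then h.choose else a p) [MOD p]
    rw [dif_neg h]; exact htp

/-- An injection from a finite set into any finite set at least as large. [folklore] -/
private theorem exists_injOn_of_card_le {S T : Finset ℕ} (h : S.card ≤ T.card) :
    ∃ q : ℕ → ℕ, Set.InjOn q S ∧ ∀ s ∈ S, q s ∈ T := by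
  classical
  obtain ⟨T', hT'T, hcardT'⟩ := le_card_iff_exists_subset_card.1 h
  let e : S ≃ T' := equivOfCardEq hcardT'.symm
  refine ⟨fun s => if hs : s ∈ S then ((e ⟨s, hs⟩ : T') : ℕ) else 0, ?_, ?_⟩
  · intro s₁ hs₁ s₂ hs₂ heq
    have hs₁' : s₁ ∈ S := by simpa using hs₁
    have hs₂' : s₂ ∈ S := by simpa using hs₂
    simp only [hs₁', hs₂', dif_pos] at heq
    have := e.injective (Subtype.ext heq)
    simpa using this
  · intro s hs
    simp only [hs, dif_pos]
    exact hT'T (e ⟨s, hs⟩).2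

/-! ### After the first two sievings -/

/-- **The survivors of `a_p = 1 (p ≤ y)`, `a_p = 0 (y < p ≤ z)`**: an `n ∈ [1, U]` with
`n ≢ 1 (mod p)` for all `p ≤ y` and no prime factor in `(y, z]` lies in `𝓡'` (if `y`-smooth) or is
`m · p` with `p ∈ 𝓡_m` (if it has a prime factor `q > y`, hence `q > z`: take `p = q`, `m = n/q`).
[cite: Maynard2016LargeGaps, §2, (2.4)–(2.6)] -/
theorem stage_one_survivor {C_U ε : ℝ} {x n : ℕ} (hn1 : 1 ≤ n) (hnU : n ≤ ⌊U C_U ε x⌋₊)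
    (hU0 : 0 ≤ U C_U ε x)
    (h1 : ∀ p : ℕ, p.Prime → p ≤ ⌊y ε x⌋₊ → ¬ n ≡ 1 [MOD p])
    (h0 : ∀ p : ℕ, p.Prime → ⌊y ε x⌋₊ < p → (p : ℝ) ≤ z x → ¬ p ∣ n) :
    n ∈ Rprime C_U ε x ∨ ∃ m p : ℕ, 1 ≤ m ∧ p ∈ Rm C_U ε x m ∧ n = m * p := by
  have hnUr : (n : ℝ) ≤ U C_U ε x := by
    have := Nat.floor_le hU0
    exact le_trans (by exact_mod_cast hnU) this
  -- `(n - 1, P_y) = 1`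
  have hcop : Nat.Coprime (n - 1) (primorial ⌊y ε x⌋₊) := by
    refine Nat.coprime_of_dvd fun k hk hkn hkP => ?_
    rw [primorial_eq_prod_primesLE, (Nat.Prime.prime hk).dvd_finsetProd_iff] at hkP
    obtain ⟨p, hp, hkp⟩ := hkP
    obtain ⟨hpY, hpp⟩ := Nat.mem_primesLE.1 hp
    have hkp' : k = p := (Nat.prime_dvd_prime_iff_eq hk hpp).1 hkp
    subst hkp'
    exact h1 k hk hpY ((Nat.modEq_iff_dvd' hn1).2 hkn).symm
  by_cases hbig : ∃ q : ℕ, q.Prime ∧ q ∣ n ∧ ⌊y ε x⌋₊ < q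
  · obtain ⟨q, hq, hqn, hYq⟩ := hbig
    have hzq : z x < q := by
      by_contra hle
      exact h0 q hq hYq (not_lt.1 hle) hqn
    obtain ⟨m, rfl⟩ := hqn
    have hm0 : m ≠ 0 := by rintro rfl; simp at hn1
    have hm1 : 1 ≤ m := Nat.one_le_iff_ne_zero.2 hm0
    refine Or.inr ⟨m, q, hm1, ?_, by ring⟩
    rw [Rm, sievedPrimes, mem_filter, mem_Icc]
    refine ⟨⟨hq.one_lt.le, ?_⟩, hq, hzq, ?_⟩
    · refine Nat.le_floor ?_
      rw [le_div_iff₀ (by exact_mod_cast hm1)]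
      calc (q : ℝ) * m = ((q * m : ℕ) : ℝ) := by push_cast; ring
        _ ≤ U C_U ε x := hnUr
    · rwa [mul_comm m q]
  · left
    rw [Rprime, mem_filter, mem_Icc]
    refine ⟨⟨hn1, hnU⟩, fun p hp => ?_, hcop⟩
    have hp' := Nat.mem_primeFactors.1 hp
    by_contra hpY
    exact hbig ⟨p, hp'.1, hp'.2.1, not_le.1 hpY⟩

/-! ### The core: one `x`, every input explicit -/

/-- **The covering of `[1, U]` at one `x`**, from the numerical inputs: the bounds of Lemma 2 and of
Lemma 4 (tail `≤ x/(8 log x)`, head `≤ K₄ C_U x/log x`), Proposition 5 with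
`δ = 1/(4(K₄ C_U + 1))`, and `≥ x/(4 log x)` primes in `(z, x/2)`; plus the orderings
`2 ≤ y ≤ z < x/2`, `y ≤ x`, `⌈U z⁻¹ (log₂ x)⁻²⌉ ≤ x/4`. [cite: Maynard2016LargeGaps, §2, proof of Theorem 1 assuming Proposition 5] -/
theorem cover_core {C_U ε K₄ δ W : ℝ} {x Y Z N : ℕ} (hK₄ : 0 < K₄) (hC : 0 < C_U)
    (hδ : δ = 1 / (4 * (K₄ * C_U + 1)))
    (hY : Y = ⌊y ε x⌋₊) (hZ : Z = ⌊z x⌋₊) (hN : N = ⌊U C_U ε x⌋₊)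
    (hy2 : 2 ≤ Y) (hYZ : Y ≤ Z) (hYx : Y ≤ x) (hz2 : 2 ≤ z x) (hzx : z x < (x : ℝ) / 2)
    (hU0 : 0 ≤ U C_U ε x) (hlog : 1 ≤ Real.log x) (hWx : (⌈W⌉₊ : ℝ) ≤ (x : ℝ) / 4)
    (hL2 : ((Rprime C_U ε x).card : ℝ) ≤ (x : ℝ) / (8 * Real.log x))
    (hL4t : (∑ m ∈ (Finset.range ⌈U C_U ε x / z x⌉₊).filter (fun m : ℕ => W ≤ m),
        ((Rm C_U ε x m).card : ℝ)) ≤ 1 / 8 * ((x : ℝ) / Real.log x))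
    (hL4h : (∑ m ∈ (Finset.range ⌈W⌉₊).filter (fun m : ℕ => 1 ≤ m),
        ((Rm C_U ε x m).card : ℝ)) ≤ K₄ * (C_U * (x : ℝ) / Real.log x))
    (hP5 : ∀ m : ℕ, 1 ≤ m → Even m → (m : ℝ) < W → ∀ A B : ℝ, (x : ℝ) / 2 ≤ A → B ≤ x →
        δ * (Rm C_U ε x m).card * Real.log x ≤ B - A →
          ∃ a : ℕ → ℕ, ∀ p ∈ Rm C_U ε x m,
            ∃ q : ℕ, q.Prime ∧ A ≤ (q : ℝ) ∧ (q : ℝ) ≤ B ∧ p ≡ a q [MOD q])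
    (hmid : (x : ℝ) / (4 * Real.log x) ≤
        (((Finset.Ioc Z x).filter (fun q : ℕ => q.Prime ∧ 2 * q < x)).card : ℝ)) :
    ResidueClassesCover x N := by
  classical
  have hx0 : (0 : ℝ) < x := by linarith
  have hlog0 : 0 < Real.log x := by linarith
  have hδ0 : 0 < δ := by rw [hδ]; positivity
  have hZx : Z ≤ x := by
    have h1 : (Z : ℝ) ≤ z x := by rw [hZ]; exact Nat.floor_le (by linarith)
    exact_mod_cast (show (Z : ℝ) ≤ x by linarith)
  -- the even `m < W`
  set M : Finset ℕ := (Finset.range ⌈W⌉₊).filter (fun m : ℕ => 1 ≤ m ∧ Even m) with hM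
  have hMmem : ∀ {m : ℕ}, m ∈ M ↔ (m : ℝ) < W ∧ 1 ≤ m ∧ Even m := by
    intro m; rw [hM, mem_filter, mem_range, Nat.lt_ceil]
  -- the lengths `ℓ_m = δ |𝓡_m| log x` and the partial sums
  obtain ⟨ℓ, hℓ⟩ : ∃ ℓ : ℕ → ℝ, ∀ m, ℓ m = δ * (Rm C_U ε x m).card * Real.log x :=
    ⟨_, fun _ => rfl⟩
  have hℓ0 : ∀ m, 0 ≤ ℓ m := fun m => by rw [hℓ]; positivity
  obtain ⟨S, hS⟩ : ∃ S : ℕ → ℝ, ∀ m, S m = ∑ m' ∈ M.filter (fun m' => m' < m), (ℓ m' + 1) :=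
    ⟨_, fun _ => rfl⟩
  have hS0 : ∀ m, 0 ≤ S m := fun m => by
    rw [hS]; exact sum_nonneg fun m' _ => by linarith [hℓ0 m']
  -- total length `≤ x/2`
  have htot : (∑ m' ∈ M, (ℓ m' + 1)) ≤ (x : ℝ) / 2 := by
    rw [sum_add_distrib, sum_const, nsmul_eq_mul, mul_one]
    have h1 : (∑ m' ∈ M, ℓ m') ≤ (x : ℝ) / 4 := by
      have h2 : (∑ m' ∈ M, ℓ m') = δ * Real.log x *
          ∑ m' ∈ M, ((Rm C_U ε x m').card : ℝ) := by
        rw [mul_sum]; exact sum_congr rfl fun m' _ => by rw [hℓ]; ring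
      have h3 : (∑ m' ∈ M, ((Rm C_U ε x m').card : ℝ)) ≤
          ∑ m ∈ (Finset.range ⌈W⌉₊).filter (fun m : ℕ => 1 ≤ m), ((Rm C_U ε x m).card : ℝ) := by
        refine sum_le_sum_of_subset_of_nonneg ?_ fun _ _ _ => by positivity
        intro m hm
        rw [hM, mem_filter] at hm
        exact mem_filter.2 ⟨hm.1, hm.2.1⟩
      rw [h2]
      calc δ * Real.log x * ∑ m' ∈ M, ((Rm C_U ε x m').card : ℝ)
          ≤ δ * Real.log x * (K₄ * (C_U * (x : ℝ) / Real.log x)) :=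
            mul_le_mul_of_nonneg_left (h3.trans hL4h) (by positivity)
        _ = δ * (K₄ * C_U) * x := by field_simp
        _ ≤ 1 / 4 * x := by
            refine mul_le_mul_of_nonneg_right ?_ hx0.le
            rw [hδ, div_mul_eq_mul_div, one_mul, div_le_iff₀ (by positivity)]
            linarith
        _ = (x : ℝ) / 4 := by ring
    have h2 : (M.card : ℝ) ≤ (x : ℝ) / 4 := by
      have : M.card ≤ ⌈W⌉₊ := (card_filter_le _ _).trans (by simp)
      exact le_trans (by exact_mod_cast this) hWx
    linarith
  -- partial sums: `S m + ℓ m + 1 ≤ total` for `m ∈ M`, and separation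
  have hSsplit : ∀ m ∈ M, ∀ m₂, m < m₂ →
      S m + (ℓ m + 1) ≤ ∑ m' ∈ M.filter (fun m' => m' < m₂), (ℓ m' + 1) := by
    intro m hm m₂ hmm₂
    rw [hS]
    have hdisj : Disjoint (M.filter (fun m' => m' < m)) {m} := by
      rw [disjoint_singleton_right, mem_filter]; omega
    have hsub : M.filter (fun m' => m' < m) ∪ {m} ⊆ M.filter (fun m' => m' < m₂) := by
      intro m' hm'
      rcases mem_union.1 hm' with h | h
      · rw [mem_filter] at h ⊢; exact ⟨h.1, h.2.trans hmm₂⟩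
      · rw [mem_singleton] at h; subst h; exact mem_filter.2 ⟨hm, hmm₂⟩
    have := sum_le_sum_of_subset_of_nonneg hsub
      (f := fun m' => ℓ m' + 1) (fun m' _ _ => by linarith [hℓ0 m'])
    rwa [sum_union hdisj, sum_singleton] at this
  have hSle : ∀ m ∈ M, S m + ℓ m + 1 ≤ (x : ℝ) / 2 := by
    intro m hm
    have hmW : m < ⌈W⌉₊ := by
      have := (hMmem.1 hm).1; exact Nat.lt_ceil.2 this
    have h1 := hSsplit m hm ⌈W⌉₊ hmW
    have h2 : (∑ m' ∈ M.filter (fun m' => m' < ⌈W⌉₊), (ℓ m' + 1)) ≤ ∑ m' ∈ M, (ℓ m' + 1) :=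
      sum_le_sum_of_subset_of_nonneg (filter_subset _ _) fun m' _ _ => by linarith [hℓ0 m']
    linarith
  have hsep : ∀ m₁ ∈ M, ∀ m₂ ∈ M, m₁ < m₂ → S m₁ + ℓ m₁ + 1 ≤ S m₂ := by
    intro m₁ hm₁ m₂ _ h12
    have := hSsplit m₁ hm₁ m₂ h12
    rw [hS m₂]; linarith
  -- the intervals `[A m, B m] = [x/2 + S m, x/2 + S m + ℓ m]`
  have huniq : ∀ m₁ ∈ M, ∀ m₂ ∈ M, ∀ q : ℝ,
      (x : ℝ) / 2 + S m₁ ≤ q → q ≤ (x : ℝ) / 2 + S m₁ + ℓ m₁ →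
      (x : ℝ) / 2 + S m₂ ≤ q → q ≤ (x : ℝ) / 2 + S m₂ + ℓ m₂ → m₁ = m₂ := by
    intro m₁ hm₁ m₂ hm₂ q h1 h2 h3 h4
    by_contra hne
    rcases lt_or_gt_of_ne hne with h | h
    · have := hsep m₁ hm₁ m₂ hm₂ h; linarith
    · have := hsep m₂ hm₂ m₁ hm₁ h; linarith
  -- Proposition 5 on each interval
  have hch : ∀ m : ℕ, ∃ a : ℕ → ℕ, m ∈ M → ∀ p ∈ Rm C_U ε x m,
      ∃ q : ℕ, q.Prime ∧ (x : ℝ) / 2 + S m ≤ (q : ℝ) ∧ (q : ℝ) ≤ (x : ℝ) / 2 + S m + ℓ m ∧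
        p ≡ a q [MOD q] := by
    intro m
    by_cases hm : m ∈ M
    · obtain ⟨hmW, hm1, hmev⟩ := hMmem.1 hm
      obtain ⟨a, ha⟩ := hP5 m hm1 hmev hmW ((x : ℝ) / 2 + S m) ((x : ℝ) / 2 + S m + ℓ m)
        (by linarith [hS0 m]) (by linarith [hSle m hm]) (by rw [hℓ]; linarith)
      exact ⟨a, fun _ => ha⟩
    · exact ⟨fun _ => 0, fun h => absurd h hm⟩
  choose am ham using hch
  -- the assignment for the primes `≤ z` and the primes in the intervals
  obtain ⟨a₀, ha₀Y, ha₀Z, ha₀I⟩ : ∃ a₀ : ℕ → ℕ, (∀ q, q ≤ Y → a₀ q = 1) ∧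
      (∀ q, Y < q → q ≤ Z → a₀ q = 0) ∧
      (∀ q, Z < q → ∀ m ∈ M, (x : ℝ) / 2 + S m ≤ (q : ℝ) → (q : ℝ) ≤ (x : ℝ) / 2 + S m + ℓ m →
        a₀ q = m * am m q) := by
    refine ⟨fun q => if q ≤ Y then 1 else if q ≤ Z then 0 else
      if h : ∃ m ∈ M, (x : ℝ) / 2 + S m ≤ (q : ℝ) ∧ (q : ℝ) ≤ (x : ℝ) / 2 + S m + ℓ m
      then h.choose * am h.choose q else 0, fun q hq => by simp [hq], fun q hq1 hq2 => by
        simp [not_le.2 hq1, hq2], fun q hqZ m hm h1 h2 => ?_⟩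
    have hqY : ¬ q ≤ Y := by omega
    have hqZ' : ¬ q ≤ Z := by omega
    have h : ∃ m ∈ M, (x : ℝ) / 2 + S m ≤ (q : ℝ) ∧ (q : ℝ) ≤ (x : ℝ) / 2 + S m + ℓ m :=
      ⟨m, hm, h1, h2⟩
    simp only [hqY, hqZ', if_false, dif_pos h]
    have hm' : h.choose = m :=
      huniq _ h.choose_spec.1 m hm q h.choose_spec.2.1 h.choose_spec.2.2 h1 h2
    rw [hm']
  -- the middle primes and the leftover set
  set Q : Finset ℕ := (Finset.Ioc Z x).filter (fun q : ℕ => q.Prime ∧ 2 * q < x) with hQ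
  set T : Finset ℕ := (Finset.Icc 1 N).filter
    (fun t => ¬ ∃ p : ℕ, p.Prime ∧ p ≤ x ∧ p ∉ Q ∧ t ≡ a₀ p [MOD p]) with hT
  have hcovT : ∀ t : ℕ, 1 ≤ t → t ≤ N → t ∉ T →
      ∃ p : ℕ, p.Prime ∧ p ≤ x ∧ p ∉ Q ∧ t ≡ a₀ p [MOD p] := by
    intro t ht1 htN htT
    by_contra h
    exact htT (mem_filter.2 ⟨mem_Icc.2 ⟨ht1, htN⟩, h⟩)
  have hQp : ∀ p ∈ Q, p.Prime ∧ p ≤ x := fun p hp => by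
    rw [hQ, mem_filter, mem_Ioc] at hp; exact ⟨hp.2.1, hp.1.2⟩
  -- what is left lies in `𝓡'` or in `m · 𝓡_m` for some `m ≥ W`
  have hTsub : T ⊆ Rprime C_U ε x ∪
      ((Finset.range ⌈U C_U ε x / z x⌉₊).filter (fun m : ℕ => W ≤ m)).biUnion
        (fun m => (Rm C_U ε x m).image (fun p => m * p)) := by
    intro t ht
    rw [hT, mem_filter, mem_Icc] at ht
    obtain ⟨⟨ht1, htN⟩, hno⟩ := ht
    have key : ∀ p : ℕ, p.Prime → p ≤ x → p ∉ Q → ¬ t ≡ a₀ p [MOD p] :=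
      fun p hp hpx hpQ hmod => hno ⟨p, hp, hpx, hpQ, hmod⟩
    have notQ_of_le : ∀ p : ℕ, p ≤ Z → p ∉ Q := by
      intro p hp hpQ; rw [hQ, mem_filter, mem_Ioc] at hpQ; omega
    have h1 : ∀ p : ℕ, p.Prime → p ≤ ⌊y ε x⌋₊ → ¬ t ≡ 1 [MOD p] := by
      intro p hp hpY hmod
      rw [← hY] at hpY
      refine key p hp (hpY.trans hYx) (notQ_of_le p (hpY.trans hYZ)) ?_
      rwa [ha₀Y p hpY]
    have h0 : ∀ p : ℕ, p.Prime → ⌊y ε x⌋₊ < p → (p : ℝ) ≤ z x → ¬ p ∣ t := by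
      intro p hp hYp hpz hpt
      rw [← hY] at hYp
      have hpZ : p ≤ Z := by rw [hZ]; exact Nat.le_floor hpz
      refine key p hp (hpZ.trans hZx) (notQ_of_le p hpZ) ?_
      rw [ha₀Z p hYp hpZ]
      exact Nat.modEq_zero_iff_dvd.2 hpt
    rcases stage_one_survivor ht1 (hN ▸ htN) hU0 h1 h0 with hR' | ⟨m, p, hm1, hpR, htmp⟩
    · exact mem_union_left _ hR'
    · have hpR' := hpR
      rw [Rm, sievedPrimes, mem_filter, mem_Icc] at hpR'
      obtain ⟨⟨-, hpU⟩, hp, hzp, -⟩ := hpR'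
      -- `m` is even (else `𝓡_m = ∅`)
      have hmev : Even m := by
        by_contra hodd
        rw [Nat.not_even_iff_odd] at hodd
        rw [Rm_eq_empty_of_odd (hY ▸ hy2) hz2 hodd] at hpR
        simp at hpR
      -- `m ≥ W` (else Proposition 5 covered `t = m p`)
      have hmW : W ≤ m := by
        by_contra hlt
        rw [not_le] at hlt
        have hmM : m ∈ M := hMmem.2 ⟨hlt, hm1, hmev⟩
        obtain ⟨q, hq, hq1, hq2, hpq⟩ := ham m hmM p hpR
        have hqx : q ≤ x := by
          have := hSle m hmM
          exact_mod_cast (show (q : ℝ) ≤ x by linarith)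
        have hZq : Z < q := by
          have h1' : (Z : ℝ) ≤ z x := by rw [hZ]; exact Nat.floor_le (by linarith)
          have : (Z : ℝ) < q := by linarith [hS0 m]
          exact_mod_cast this
        have hqQ : q ∉ Q := by
          intro hqQ
          rw [hQ, mem_filter, mem_Ioc] at hqQ
          have : (2 * q : ℕ) < (x : ℝ) := by exact_mod_cast hqQ.2.2
          push_cast at this
          linarith [hS0 m]
        refine key q hq hqx hqQ ?_
        rw [ha₀I q hZq m hmM hq1 hq2, htmp]
        exact hpq.mul_left m
      refine mem_union_right _ (mem_biUnion.2 ⟨m, mem_filter.2 ⟨mem_range.2 ?_, hmW⟩,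
        mem_image.2 ⟨p, hpR, htmp.symm⟩⟩)
      -- `m < U/z` since `m z < m p = t ≤ U`
      refine Nat.lt_ceil.2 ?_
      rw [lt_div_iff₀ (by linarith)]
      have htU : ((m * p : ℕ) : ℝ) ≤ U C_U ε x := by
        rw [← htmp]
        exact le_trans (by exact_mod_cast hN ▸ htN) (Nat.floor_le hU0)
      push_cast at htU
      have hm1r : (1 : ℝ) ≤ m := by exact_mod_cast hm1
      nlinarith
  -- count: `|T| ≤ |𝓡'| + Σ_{m ≥ W} |𝓡_m| ≤ x/(4 log x) ≤ |Q|`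
  have hTcard : T.card ≤ Q.card := by
    have h1 : (T.card : ℝ) ≤ (Rprime C_U ε x).card +
        ∑ m ∈ (Finset.range ⌈U C_U ε x / z x⌉₊).filter (fun m : ℕ => W ≤ m),
          ((Rm C_U ε x m).card : ℝ) := by
      have h2 := (card_le_card hTsub).trans (card_union_le _ _)
      have h3 := card_biUnion_le (s := (Finset.range ⌈U C_U ε x / z x⌉₊).filter
        (fun m : ℕ => W ≤ m)) (t := fun m => (Rm C_U ε x m).image (fun p => m * p))
      have h4 : (∑ m ∈ (Finset.range ⌈U C_U ε x / z x⌉₊).filter (fun m : ℕ => W ≤ m),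
          ((Rm C_U ε x m).image (fun p => m * p)).card) ≤
          ∑ m ∈ (Finset.range ⌈U C_U ε x / z x⌉₊).filter (fun m : ℕ => W ≤ m),
            (Rm C_U ε x m).card := sum_le_sum fun m _ => card_image_le
      have h5 := h2.trans (Nat.add_le_add_left (h3.trans h4) _)
      exact_mod_cast h5
    have h2 : (T.card : ℝ) ≤ (x : ℝ) / (4 * Real.log x) := by
      have : (x : ℝ) / (8 * Real.log x) + 1 / 8 * ((x : ℝ) / Real.log x) =
          (x : ℝ) / (4 * Real.log x) := by
        field_simp; ring
      linarith
    exact_mod_cast h2.trans hmid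
  obtain ⟨q, hinj, hq⟩ := exists_injOn_of_card_le hTcard
  exact residueClassesCover_of_injOn_compl Q a₀ T hcovT q hinj hq hQp

/-! ### Growth of the parameters -/

/-- `log t ≤ t/2` for `t > 0`. [folklore] -/
private theorem log_le_half {t : ℝ} (ht : 0 < t) : Real.log t ≤ t / 2 := by
  have h1 := Real.log_le_sub_one_of_pos (half_pos ht)
  have h2 : Real.log (t / 2) = Real.log t - Real.log 2 := Real.log_div ht.ne' two_ne_zero
  have h3 : Real.log 2 < 1 := by have := Real.log_two_lt_d9; norm_num at this; linarith
  linarith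

/-- The orderings and sizes of `y, z, U` for all large `x`: `2 ≤ y ≤ z < x/2`, `y ≤ x`, `U ≥ 0`,
`log x ≥ 1`, `⌈U z⁻¹ (log₂ x)⁻²⌉ ≤ x/4`. [cite: Maynard2016LargeGaps, (2.1)] -/
private theorem eventually_growth {C_U ε : ℝ} (hC : 0 < C_U) (hε0 : 0 < ε) (hε : ε < 1 / 2) :
    ∀ᶠ x : ℕ in atTop,
      2 ≤ ⌊y ε x⌋₊ ∧ ⌊y ε x⌋₊ ≤ ⌊z x⌋₊ ∧ ⌊y ε x⌋₊ ≤ x ∧ 2 ≤ z x ∧ z x < (x : ℝ) / 2 ∧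
      0 ≤ U C_U ε x ∧ 1 ≤ Real.log x ∧
      (⌈U C_U ε x / (z x * Real.log (Real.log x) ^ 2)⌉₊ : ℝ) ≤ (x : ℝ) / 4 := by
  have hT₂ : Tendsto (fun X : ℝ => Real.log (Real.log X)) atTop atTop :=
    Real.tendsto_log_atTop.comp Real.tendsto_log_atTop
  have hlin := Real.isLittleO_log_id_atTop.bound (show (0 : ℝ) < 1 / (8 * C_U) by positivity)
  have hreal : ∀ᶠ X : ℝ in atTop, 4 ≤ Real.log (Real.log X) ∧ 1 ≤ Real.log X ∧ 8 ≤ X ∧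
      C_U * Real.log X + 1 ≤ X / 4 := by
    filter_upwards [hT₂.eventually_ge_atTop 4, hlin, eventually_ge_atTop (8 : ℝ),
      Real.tendsto_log_atTop.eventually_ge_atTop 1] with X h4 hlinX hX8 hlog1
    refine ⟨h4, hlog1, hX8, ?_⟩
    rw [Real.norm_eq_abs, Real.norm_eq_abs, id, abs_of_nonneg (by linarith),
      abs_of_nonneg (by linarith)] at hlinX
    have : C_U * Real.log X ≤ X / 8 := by
      have h := mul_le_mul_of_nonneg_left hlinX hC.le
      calc C_U * Real.log X ≤ C_U * (1 / (8 * C_U) * X) := h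
        _ = X / 8 := by field_simp
    linarith
  filter_upwards [tendsto_natCast_atTop_atTop.eventually hreal] with x hx
  obtain ⟨h4, hlog1, hx8, hlinx⟩ := hx
  have hx0 : (0 : ℝ) < x := by linarith
  have hL0 : 0 < Real.log (x : ℝ) := by linarith
  have hL₂0 : 0 < Real.log (Real.log (x : ℝ)) := by linarith
  have hL₂le : Real.log (Real.log (x : ℝ)) ≤ Real.log x / 2 := log_le_half hL0
  have hL₃le : Real.log (Real.log (Real.log (x : ℝ))) ≤ Real.log (Real.log x) / 2 :=
    log_le_half hL₂0
  have hL₃1 : 1 ≤ Real.log (Real.log (Real.log (x : ℝ))) := by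
    have he4 : Real.exp 1 ≤ 4 := by have := Real.exp_one_lt_d9; linarith
    have h1 : (1 : ℝ) ≤ Real.log 4 := by
      have := Real.log_le_log (Real.exp_pos 1) he4; rwa [Real.log_exp] at this
    exact h1.trans (Real.log_le_log (by norm_num) h4)
  -- `1 ≤ log y ≤ (log x)/2`
  have hTnn : 0 ≤ Real.log (x : ℝ) * Real.log (Real.log (Real.log x)) / Real.log (Real.log x) := by
    positivity
  have hlogy1 : 1 ≤ Real.log (y ε x) := by
    rw [log_y]
    have h1 : 2 ≤ Real.log (x : ℝ) * Real.log (Real.log (Real.log x)) / Real.log (Real.log x) := by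
      rw [le_div_iff₀ hL₂0]
      nlinarith
    nlinarith
  have hlogyle : Real.log (y ε x) ≤ Real.log x / 2 := by
    rw [log_y]
    have h1 : Real.log (x : ℝ) * Real.log (Real.log (Real.log x)) / Real.log (Real.log x) ≤
        Real.log x / 2 := by
      rw [div_le_iff₀ hL₂0]
      nlinarith
    nlinarith
  have hy0 : 0 < y ε x := Real.exp_pos _
  have hz0 : 0 < z x := by rw [z]; positivity
  -- `log z = log x - log₃ x ≥ (3/4) log x`
  have hlogz : Real.log (z x) = Real.log x - Real.log (Real.log (Real.log x)) := by
    rw [z, Real.log_div hx0.ne' hL₂0.ne']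
  refine ⟨?_, ?_, ?_, ?_, ?_, ?_, hlog1, ?_⟩
  · -- `2 ≤ ⌊y⌋`
    refine Nat.le_floor ?_
    have h2 : Real.log 2 < 1 := by have := Real.log_two_lt_d9; norm_num at this; linarith
    have : Real.log 2 ≤ Real.log (y ε x) := by linarith
    exact_mod_cast (Real.log_le_log_iff (by norm_num) hy0).1 this
  · -- `⌊y⌋ ≤ ⌊z⌋`
    refine Nat.floor_le_floor ((Real.log_le_log_iff hy0 hz0).1 ?_)
    rw [hlogz]; linarith
  · -- `⌊y⌋ ≤ x`
    have : y ε x ≤ (x : ℝ) := (Real.log_le_log_iff hy0 hx0).1 (by linarith)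
    exact (Nat.floor_le_floor this).trans (Nat.floor_natCast x).le
  · -- `2 ≤ z`
    rw [z, le_div_iff₀ hL₂0]
    have := log_le_half hx0
    linarith
  · -- `z < x/2`
    rw [z]
    exact div_lt_div_of_pos_left hx0 two_pos (by linarith)
  · -- `0 ≤ U`
    rw [U]
    exact mul_nonneg hC.le (div_nonneg (mul_nonneg hx0.le (by linarith)) hL₂0.le)
  · -- `⌈U/(z log₂² x)⌉ ≤ x/4`
    have hWeq : U C_U ε x / (z x * Real.log (Real.log x) ^ 2) =
        C_U * Real.log (y ε x) / Real.log (Real.log x) ^ 2 := by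
      rw [U, z]
      field_simp
    have hW0 : 0 ≤ C_U * Real.log (y ε x) / Real.log (Real.log x) ^ 2 := by positivity
    have hWle : C_U * Real.log (y ε x) / Real.log (Real.log x) ^ 2 ≤ C_U * Real.log x := by
      have h1 : C_U * Real.log (y ε x) / Real.log (Real.log x) ^ 2 ≤ C_U * Real.log (y ε x) :=
        div_le_self (by positivity) (by nlinarith)
      have h2 : C_U * Real.log (y ε x) ≤ C_U * Real.log x :=
        mul_le_mul_of_nonneg_left (by linarith) hC.le
      linarith
    rw [hWeq]
    have := Nat.ceil_lt_add_one hW0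
    linarith

/-- Lemma 2's bound made absolute: `K x/(log x)^{1+ε} ≤ x/(8 log x)` once `(log x)^ε ≥ 8K`.
[cite: Maynard2016LargeGaps, Lemma 2] -/
private theorem eventually_Rprime_le {C_U ε K₂ : ℝ} (hK₂ : 0 < K₂) (hε0 : 0 < ε)
    (h : ∀ᶠ x : ℕ in atTop,
      ((Rprime C_U ε x).card : ℝ) ≤ K₂ * (x : ℝ) / Real.log x ^ (1 + ε)) :
    ∀ᶠ x : ℕ in atTop, ((Rprime C_U ε x).card : ℝ) ≤ (x : ℝ) / (8 * Real.log x) := by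
  have ht : Tendsto (fun X : ℝ => Real.log X ^ ε) atTop atTop :=
    (tendsto_rpow_atTop hε0).comp Real.tendsto_log_atTop
  have hreal : ∀ᶠ X : ℝ in atTop, 8 * K₂ ≤ Real.log X ^ ε ∧ 0 < Real.log X := by
    filter_upwards [ht.eventually_ge_atTop (8 * K₂), Real.tendsto_log_atTop.eventually_gt_atTop 0]
      with X h1 h2
    exact ⟨h1, h2⟩
  filter_upwards [h, tendsto_natCast_atTop_atTop.eventually hreal] with x hx hx'
  obtain ⟨hpow, hlog0⟩ := hx'
  refine hx.trans ?_
  have hsplit : Real.log (x : ℝ) ^ (1 + ε) = Real.log x * Real.log x ^ ε := by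
    rw [Real.rpow_add hlog0, Real.rpow_one]
  rw [hsplit]
  calc K₂ * (x : ℝ) / (Real.log x * Real.log x ^ ε) ≤ K₂ * x / (Real.log x * (8 * K₂)) := by
        apply div_le_div_of_nonneg_left (by positivity) (by positivity)
        exact mul_le_mul_of_nonneg_left hpow hlog0.le
    _ = (x : ℝ) / (8 * Real.log x) := by field_simp

/-! ### The primes in `(z, x/2)` (prime number theorem) -/

open Asymptotics in
/-- The prime number theorem (tree: `primeCounting_isEquivalent_holds`) as two-sided bounds.
[folklore] -/
private theorem eventually_abs_primeCounting_sub_le {κ : ℝ} (hκ : 0 < κ) :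
    ∀ᶠ X : ℝ in atTop,
      |(Nat.primeCounting ⌊X⌋₊ : ℝ) - X / Real.log X| ≤ κ * (X / Real.log X) := by
  have h0 : (fun X : ℝ ↦ (Nat.primeCounting ⌊X⌋₊ : ℝ)) ~[atTop] fun X ↦ X / Real.log X :=
    Literature.NumberTheory.LFunctions.primeCounting_isEquivalent_holds
  filter_upwards [h0.isLittleO.bound hκ, eventually_ge_atTop (1 : ℝ)] with X hX hX1
  have hX0 : 0 ≤ X := by linarith
  have hl0 : 0 ≤ Real.log X := Real.log_nonneg hX1
  have hnn : 0 ≤ X / Real.log X := div_nonneg hX0 hl0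
  simpa [Real.norm_eq_abs, abs_div, abs_of_nonneg hnn, abs_of_nonneg hX0, abs_of_nonneg hl0]
    using hX

/-- `π(n) = #(primes < n + 1)`. [folklore] -/
private theorem primeCounting_eq_card_primesBelow (n : ℕ) :
    Nat.primeCounting n = ((n + 1).primesBelow).card := by
  rw [Nat.primesBelow_card_eq_primeCounting']; rfl

/-- `z(x) → ∞` (indeed `z ≥ √x`). [cite: Maynard2016LargeGaps, (2.1)] -/
private theorem tendsto_z_atTop : Tendsto (fun x : ℕ => z x) atTop atTop := by
  have h1 : Tendsto (fun X : ℝ => X ^ ((1 : ℝ) / 2)) atTop atTop := tendsto_rpow_atTop (by norm_num)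
  refine tendsto_atTop_mono' atTop ?_ (h1.comp tendsto_natCast_atTop_atTop)
  have hreal : ∀ᶠ X : ℝ in atTop, 0 < Real.log (Real.log X) ∧ 1 < Real.log X ∧ 0 < X := by
    filter_upwards [(Real.tendsto_log_atTop.comp Real.tendsto_log_atTop).eventually_gt_atTop 0,
      Real.tendsto_log_atTop.eventually_gt_atTop 1, eventually_gt_atTop (0 : ℝ)] with X h1 h2 h3
    exact ⟨h1, h2, h3⟩
  filter_upwards [tendsto_natCast_atTop_atTop.eventually hreal] with x hx
  obtain ⟨hL₂0, hL1, hx0⟩ := hx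
  show (x : ℝ) ^ ((1 : ℝ) / 2) ≤ z x
  rw [z, le_div_iff₀ hL₂0]
  have hsq : (x : ℝ) = (x : ℝ) ^ ((1 : ℝ) / 2) * (x : ℝ) ^ ((1 : ℝ) / 2) := by
    rw [← Real.rpow_add hx0]; norm_num
  have hr0 : 0 < (x : ℝ) ^ ((1 : ℝ) / 2) := by positivity
  have hL₂le : Real.log (Real.log (x : ℝ)) ≤ (x : ℝ) ^ ((1 : ℝ) / 2) := by
    have h1 : Real.log (Real.log (x : ℝ)) ≤ Real.log x / 2 := log_le_half (by linarith)
    have h2 : Real.log (x : ℝ) = 2 * Real.log ((x : ℝ) ^ ((1 : ℝ) / 2)) := by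
      rw [Real.log_rpow hx0]; ring
    have h3 : Real.log ((x : ℝ) ^ ((1 : ℝ) / 2)) ≤ (x : ℝ) ^ ((1 : ℝ) / 2) / 2 := log_le_half hr0
    linarith
  calc (x : ℝ) ^ ((1 : ℝ) / 2) * Real.log (Real.log x)
      ≤ (x : ℝ) ^ ((1 : ℝ) / 2) * (x : ℝ) ^ ((1 : ℝ) / 2) := mul_le_mul_of_nonneg_left hL₂le hr0.le
    _ = x := hsq.symm

/-- **At least `x/(4 log x)` primes in `(z, x/2)`** for all large `x` (prime number theorem at
`(x−1)/2` and at `z = x/log₂ x`). [cite: Maynard2016LargeGaps, §2, proof of Theorem 1 ("for each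
prime in `[z, x/2]`")] -/
private theorem eventually_card_midPrimes_ge :
    ∀ᶠ x : ℕ in atTop, (x : ℝ) / (4 * Real.log x) ≤
      (((Finset.Ioc ⌊z x⌋₊ x).filter (fun q : ℕ => q.Prime ∧ 2 * q < x)).card : ℝ) := by
  have hh : Tendsto (fun x : ℕ => ((((x - 1) / 2 : ℕ)) : ℝ)) atTop atTop := by
    refine tendsto_natCast_atTop_atTop.comp ?_
    refine tendsto_atTop_atTop.2 fun b => ⟨2 * b + 1, fun x hx => ?_⟩
    omega
  have hpnt := eventually_abs_primeCounting_sub_le (show (0 : ℝ) < 1 / 4 by norm_num)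
  have hlin := Real.isLittleO_log_id_atTop.bound (show (0 : ℝ) < 1 / 12 by norm_num)
  have hreal : ∀ᶠ X : ℝ in atTop, 40 ≤ Real.log (Real.log X) ∧ 1 ≤ Real.log X ∧ 20 ≤ X ∧
      Real.log X ≤ 1 / 12 * X := by
    filter_upwards [(Real.tendsto_log_atTop.comp Real.tendsto_log_atTop).eventually_ge_atTop 40,
      Real.tendsto_log_atTop.eventually_ge_atTop 1, eventually_ge_atTop (20 : ℝ), hlin]
      with X h1 h2 h3 h4
    refine ⟨h1, h2, h3, ?_⟩
    rwa [Real.norm_eq_abs, Real.norm_eq_abs, id, abs_of_nonneg (by linarith),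
      abs_of_nonneg (by linarith)] at h4
  filter_upwards [hh.eventually hpnt, tendsto_z_atTop.eventually hpnt,
    tendsto_natCast_atTop_atTop.eventually hreal] with x hlow hup hx
  obtain ⟨hL₂, hL1, hx20, hlinx⟩ := hx
  have hx0 : (0 : ℝ) < x := by linarith
  have hL0 : 0 < Real.log (x : ℝ) := by linarith
  have hL₂0 : 0 < Real.log (Real.log (x : ℝ)) := by linarith
  have hx20' : 20 ≤ x := by exact_mod_cast hx20
  -- the lower count at `h = (x-1)/2`
  have hhx : ((x - 1) / 2 : ℕ) ≤ x := by omega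
  have hh9 : 9 ≤ ((x - 1) / 2 : ℕ) := by omega
  have hh2 : (x : ℝ) ≤ 2 * (((x - 1) / 2 : ℕ) : ℝ) + 2 := by
    have : x ≤ 2 * ((x - 1) / 2) + 2 := by omega
    exact_mod_cast this
  rw [Nat.floor_natCast] at hlow
  have hh0 : (0 : ℝ) < (((x - 1) / 2 : ℕ) : ℝ) := by exact_mod_cast (show 0 < (x - 1) / 2 by omega)
  have hlogh0 : 0 < Real.log (((x - 1) / 2 : ℕ) : ℝ) :=
    Real.log_pos (by exact_mod_cast (show 1 < (x - 1) / 2 by omega))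
  have hloghx : Real.log (((x - 1) / 2 : ℕ) : ℝ) ≤ Real.log x :=
    Real.log_le_log hh0 (by exact_mod_cast hhx)
  have hπh : 3 / 8 * ((x : ℝ) - 2) / Real.log x ≤ Nat.primeCounting ((x - 1) / 2) := by
    have h1 : 3 / 4 * ((((x - 1) / 2 : ℕ) : ℝ) / Real.log (((x - 1) / 2 : ℕ) : ℝ)) ≤
        Nat.primeCounting ((x - 1) / 2) := by
      have := (abs_le.1 hlow).1; linarith
    have h2 : (((x - 1) / 2 : ℕ) : ℝ) / Real.log x ≤
        (((x - 1) / 2 : ℕ) : ℝ) / Real.log (((x - 1) / 2 : ℕ) : ℝ) :=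
      div_le_div_of_nonneg_left hh0.le hlogh0 hloghx
    have h3 : 3 / 8 * ((x : ℝ) - 2) / Real.log x ≤ 3 / 4 * ((((x - 1) / 2 : ℕ) : ℝ) / Real.log x) := by
      rw [mul_div_assoc, show 3 / 8 * (((x : ℝ) - 2) / Real.log x) =
        3 / 4 * (((x : ℝ) - 2) / 2 / Real.log x) by ring]
      refine mul_le_mul_of_nonneg_left (div_le_div_of_nonneg_right (by linarith) hL0.le) (by norm_num)
    linarith [mul_le_mul_of_nonneg_left h2 (show (0 : ℝ) ≤ 3 / 4 by norm_num)]
  -- the upper count at `Z = ⌊z⌋`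
  have hz0 : 0 < z x := by rw [z]; positivity
  have hlogz : Real.log (z x) = Real.log x - Real.log (Real.log (Real.log x)) := by
    rw [z, Real.log_div hx0.ne' hL₂0.ne']
  have hL₃le : Real.log (Real.log (Real.log (x : ℝ))) ≤ Real.log (Real.log x) / 2 :=
    log_le_half hL₂0
  have hL₂le : Real.log (Real.log (x : ℝ)) ≤ Real.log x / 2 := log_le_half hL0
  have hlogz2 : Real.log x / 2 ≤ Real.log (z x) := by rw [hlogz]; linarith
  have hlogz0 : 0 < Real.log (z x) := by linarith
  have hπZ : (Nat.primeCounting ⌊z x⌋₊ : ℝ) ≤ (x : ℝ) / 16 / Real.log x := by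
    have h1 : (Nat.primeCounting ⌊z x⌋₊ : ℝ) ≤ 5 / 4 * (z x / Real.log (z x)) := by
      have := (abs_le.1 hup).2; linarith
    have h2 : z x / Real.log (z x) ≤ z x / (Real.log x / 2) :=
      div_le_div_of_nonneg_left hz0.le (by positivity) hlogz2
    have h3 : z x / (Real.log x / 2) = 2 * x / (Real.log (Real.log x) * Real.log x) := by
      rw [z]; field_simp
    have h4 : 2 * (x : ℝ) / (Real.log (Real.log x) * Real.log x) ≤ 2 * x / (40 * Real.log x) :=
      div_le_div_of_nonneg_left (by positivity) (by positivity)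
        (mul_le_mul_of_nonneg_right hL₂ hL0.le)
    have h5 : 5 / 4 * (2 * (x : ℝ) / (40 * Real.log x)) = x / 16 / Real.log x := by
      field_simp; ring
    linarith [mul_le_mul_of_nonneg_left (h2.trans (h3.le.trans h4)) (show (0:ℝ) ≤ 5 / 4 by norm_num)]
  -- `Q ⊇ primes ≤ h minus primes ≤ Z`
  have hQ : Nat.primeCounting ((x - 1) / 2) ≤
      ((Finset.Ioc ⌊z x⌋₊ x).filter (fun q : ℕ => q.Prime ∧ 2 * q < x)).card +
        Nat.primeCounting ⌊z x⌋₊ := by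
    rw [primeCounting_eq_card_primesBelow, primeCounting_eq_card_primesBelow]
    have hsub : ((x - 1) / 2 + 1).primesBelow \ (⌊z x⌋₊ + 1).primesBelow ⊆
        (Finset.Ioc ⌊z x⌋₊ x).filter (fun q : ℕ => q.Prime ∧ 2 * q < x) := by
      intro q hq
      rw [Finset.mem_sdiff, Nat.mem_primesBelow, Nat.mem_primesBelow] at hq
      obtain ⟨⟨hqh, hqp⟩, hqZ⟩ := hq
      have hZq : ⌊z x⌋₊ < q := by
        by_contra h; exact hqZ ⟨by omega, hqp⟩
      exact mem_filter.2 ⟨mem_Ioc.2 ⟨hZq, by omega⟩, hqp, by omega⟩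
    have := (le_card_sdiff _ _).trans (card_le_card hsub)
    omega
  have hQr : (Nat.primeCounting ((x - 1) / 2) : ℝ) ≤
      (((Finset.Ioc ⌊z x⌋₊ x).filter (fun q : ℕ => q.Prime ∧ 2 * q < x)).card : ℝ) +
        Nat.primeCounting ⌊z x⌋₊ := by exact_mod_cast hQ
  -- conclude
  have hfin : (x : ℝ) / (4 * Real.log x) ≤
      3 / 8 * ((x : ℝ) - 2) / Real.log x - x / 16 / Real.log x := by
    have h1 : 3 / 8 * ((x : ℝ) - 2) / Real.log x - x / 16 / Real.log x - x / (4 * Real.log x)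
        = ((x : ℝ) - 12) / 16 / Real.log x := by
      field_simp; ring
    have h2 : 0 ≤ ((x : ℝ) - 12) / 16 / Real.log x := by
      have : (0 : ℝ) ≤ x - 12 := by linarith
      positivity
    linarith
  linarith

/-! ### The reduction -/

/-- **PROVED: Theorem 1 assuming Proposition 5** — Lemma 2, Lemma 4 and Proposition 5 imply the
covering of `[1, U]` for every `C_U > 0` and all small `ε > 0`, i.e. the named fact
`Maynard2016.Reduction`; with `theorem1_of_coveringTheorem` this makes Lemmas 2, 4 and
Proposition 5 kernel-sufficient for `Maynard2016_theorem1` (and for every `RankinConstant c`).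
Choices: `η = 1/8` in Lemma 4's tail, `δ = 1/(4(K₄ C_U + 1))` in Proposition 5.
[cite: Maynard2016LargeGaps, §2, proof of Theorem 1 assuming Proposition 5] -/
theorem reduction_holds : Literature.NumberTheory.Sieve.Maynard2016.Reduction := by
  intro h2 h4 h5 C_U hC
  have hε : ∀ᶠ ε : ℝ in 𝓝[>] 0, 0 < ε ∧ ε < 1 / 2 :=
    (eventually_mem_nhdsWithin.mono fun ε h => Set.mem_Ioi.1 h).and
      (eventually_nhdsWithin_of_eventually_nhds (eventually_lt_nhds (by norm_num)))
  filter_upwards [h2 C_U hC, h4 C_U hC, h5 C_U hC, hε] with ε hL2 hL4 hP5 hε'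
  obtain ⟨K₂, hK₂, hL2'⟩ := hL2
  obtain ⟨hL4t, K₄, hK₄, hL4h⟩ := hL4
  have hδ0 : (0 : ℝ) < 1 / (4 * (K₄ * C_U + 1)) := by positivity
  show ∀ᶠ x : ℕ in atTop, ResidueClassesCover x ⌊U C_U ε x⌋₊
  filter_upwards [eventually_growth hC hε'.1 hε'.2, eventually_Rprime_le hK₂ hε'.1 hL2',
    hL4t (1 / 8) (by norm_num), hL4h, hP5 _ hδ0, eventually_card_midPrimes_ge]
    with x hg hL2x hL4tx hL4hx hP5x hmidx
  obtain ⟨hy2, hYZ, hYx, hz2, hzx, hU0, hlog, hWx⟩ := hg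
  exact cover_core hK₄ hC rfl rfl rfl rfl hy2 hYZ hYx hz2 hzx hU0 hlog hWx hL2x hL4tx hL4hx hP5x
    hmidx

/-- USAGE: Lemmas 2, 4 and Proposition 5 of [Maynard2016LargeGaps] are now kernel-sufficient for
its Theorem 1. -/
example (h2 : Lemma2) (h4 : Lemma4) (h5 : Proposition5) : Maynard2016_theorem1 :=
  theorem1_of_coveringTheorem (reduction_holds h2 h4 h5)

/-- USAGE: … and for Rankin's function with every constant. -/
example (h2 : Lemma2) (h4 : Lemma4) (h5 : Proposition5) (c : ℝ) : RankinConstant c :=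
  forall_rankinConstant_of_coveringTheorem (reduction_holds h2 h4 h5) c

end Maynard2016

end Literature.NumberTheory.Sieve
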